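import Summits.HubbardSuperconductivity.HubbardSuperconductivity.Theorems.ThermalWedgeTwTipContinuationEdgeOrderCoherenceFactors
import Literature.MathematicalPhysics.QuantumLattice.TorusCooperSumFermiLevel
import Literature.MathematicalPhysics.QuantumLattice.ReducedBCSTorus

/-!
# `TwTipContinuation` (stmt-HubbardSuperconductivity-1700), line `isogap-submodular-transport`,
# stub `stub_edgeOrder` — piece 3b(v): tuning the chemical potential of the BCS trial state

The mean particle number of the regularised d-wave BCS trial state at `(μ, D)` is
`N̄_L(μ) = Σ_k (1 − (ε_L(k) − μ)/√((ε_L(k) − μ)² + D²ĝ_d(k)² + D⁴))`, a CONTINUOUS function of `μ`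
(the regulator `D⁴` removes the jumps at nodal levels). Crude occupation tails and the band-edge
level counts of `TorusCooperSumFermiLevel` (`torusLevelCount_bottom_le`,
`sq_sub_torusLevelCount_top_le`) give `N̄_L(−3.75 − 4D) ≤ 0.29L² + 2L + 8` and
`N̄_L(3.75 + 5D) ≥ 1.72L² − 2L − 8`, so by the intermediate value theorem every target in
`[0.6L² − 2KL − 2, 0.9L²]` — in particular `2⌊(1−δ)L²/2⌋ − 2KL` for `δ ∈ [1/10, 2/5]` — is attained at
some `|μ| ≤ 3.8` once `L ≥ L₀(K)` (`D ≤ 1/100`). Folklore bookkeeping.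
-/

noncomputable section

namespace Summit.HubbardSuperconductivity.TwTipContinuation.IsogapTransport

open Finset Real
open Literature.MathematicalPhysics.QuantumLattice Literature.Probability.LatticeModels

variable {L : ℕ} [NeZero L]

omit [NeZero L] in
/-- `|ĝ_d(k)|² ≤ 4`. [folklore] -/
theorem dWaveGap_sq_le (k : TorusSite 2 L) : dWaveGap k ^ 2 ≤ 4 := by
  unfold dWaveGap
  have h1 := Real.abs_cos_le_one (latticeMomentum L k 0)
  have h2 := Real.abs_cos_le_one (latticeMomentum L k 1)
  rw [abs_le] at h1 h2
  nlinarith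

/-- **Continuity of the mean number in `μ`.** [folklore] -/
theorem continuous_occSum {D : ℝ} (hD : 0 < D) :
    Continuous fun μ : ℝ => ∑ k : TorusSite 2 L,
      (1 - (torusBand L k - μ) / Real.sqrt ((torusBand L k - μ) ^ 2 + D ^ 2 * dWaveGap k ^ 2 + D ^ 4)) :=
  continuous_finsetSum _ fun k _ => continuous_occupation (torusBand L k) (dWaveGap k) hD

/-- **Upper bound on the mean number**: for `τ > 0`,
`N̄_L(a) ≤ 2·#{ε_L ≤ a + τ} + L²(4D² + D⁴)/(2τ²)`. [folklore] -/
theorem occSum_le (a : ℝ) {τ D : ℝ} (hτ : 0 < τ) (hD : 0 < D) :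
    ∑ k : TorusSite 2 L, (1 - (torusBand L k - a) / Real.sqrt ((torusBand L k - a) ^ 2 + D ^ 2 * dWaveGap k ^ 2 + D ^ 4)) ≤
      2 * torusLevelCount L (a + τ) + (L : ℝ) ^ 2 * ((4 * D ^ 2 + D ^ 4) / (2 * τ ^ 2)) := by
  rw [← Finset.sum_filter_add_sum_filter_not Finset.univ (fun k : TorusSite 2 L => torusBand L k ≤ a + τ)]
  refine add_le_add ?_ ?_
  · rw [torusLevelCount_def]
    calc ∑ k ∈ Finset.univ.filter (fun k : TorusSite 2 L => torusBand L k ≤ a + τ),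
          (1 - (torusBand L k - a) / Real.sqrt ((torusBand L k - a) ^ 2 + D ^ 2 * dWaveGap k ^ 2 + D ^ 4))
        ≤ ∑ _k ∈ Finset.univ.filter (fun k : TorusSite 2 L => torusBand L k ≤ a + τ), (2 : ℝ) :=
          Finset.sum_le_sum fun k _ => (occupation_mem (torusBand L k - a) (dWaveGap k) hD).2
      _ = _ := by rw [Finset.sum_const, nsmul_eq_mul, mul_comm]
  · calc ∑ k ∈ Finset.univ.filter (fun k : TorusSite 2 L => ¬ torusBand L k ≤ a + τ),
          (1 - (torusBand L k - a) / Real.sqrt ((torusBand L k - a) ^ 2 + D ^ 2 * dWaveGap k ^ 2 + D ^ 4))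
        ≤ ∑ _k ∈ Finset.univ.filter (fun k : TorusSite 2 L => ¬ torusBand L k ≤ a + τ),
            (4 * D ^ 2 + D ^ 4) / (2 * τ ^ 2) := by
          refine Finset.sum_le_sum fun k hk => ?_
          rw [Finset.mem_filter, not_le] at hk
          have hξ : τ < torusBand L k - a := by linarith [hk.2]
          have hξ0 : 0 < torusBand L k - a := hτ.trans hξ
          refine (occupation_le_of_pos hξ0 (dWaveGap k) hD).trans ?_
          have hg := dWaveGap_sq_le k
          have hnum : D ^ 2 * dWaveGap k ^ 2 + D ^ 4 ≤ 4 * D ^ 2 + D ^ 4 := by nlinarith [sq_nonneg D]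
          calc (D ^ 2 * dWaveGap k ^ 2 + D ^ 4) / (2 * (torusBand L k - a) ^ 2)
              ≤ (4 * D ^ 2 + D ^ 4) / (2 * (torusBand L k - a) ^ 2) := by gcongr
            _ ≤ (4 * D ^ 2 + D ^ 4) / (2 * τ ^ 2) := by
                gcongr
      _ ≤ ∑ _k : TorusSite 2 L, (4 * D ^ 2 + D ^ 4) / (2 * τ ^ 2) :=
          Finset.sum_le_sum_of_subset_of_nonneg (Finset.filter_subset _ _) fun _ _ _ => by positivity
      _ = _ := by rw [Finset.sum_const, Finset.card_univ, card_torusSite_two, nsmul_eq_mul]; push_cast; ring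

/-- **Lower bound on the mean number**: for `E + τ < b`, `τ > 0`,
`(2 − (4D² + D⁴)/(2τ²)) · #{ε_L ≤ E} ≤ N̄_L(b)`. [folklore] -/
theorem le_occSum (b : ℝ) {E τ D : ℝ} (hτ : 0 < τ) (hE : E + τ < b) (hD : 0 < D) :
    (2 - (4 * D ^ 2 + D ^ 4) / (2 * τ ^ 2)) * torusLevelCount L E ≤
      ∑ k : TorusSite 2 L, (1 - (torusBand L k - b) / Real.sqrt ((torusBand L k - b) ^ 2 + D ^ 2 * dWaveGap k ^ 2 + D ^ 4)) := by
  rw [torusLevelCount_def]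
  calc (2 - (4 * D ^ 2 + D ^ 4) / (2 * τ ^ 2)) * ((Finset.univ.filter fun k : TorusSite 2 L => torusBand L k ≤ E).card : ℝ)
      = ∑ _k ∈ Finset.univ.filter (fun k : TorusSite 2 L => torusBand L k ≤ E), (2 - (4 * D ^ 2 + D ^ 4) / (2 * τ ^ 2)) := by
        rw [Finset.sum_const, nsmul_eq_mul, mul_comm]
    _ ≤ ∑ k ∈ Finset.univ.filter (fun k : TorusSite 2 L => torusBand L k ≤ E),
          (1 - (torusBand L k - b) / Real.sqrt ((torusBand L k - b) ^ 2 + D ^ 2 * dWaveGap k ^ 2 + D ^ 4)) := by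
        refine Finset.sum_le_sum fun k hk => ?_
        rw [Finset.mem_filter] at hk
        have hξ : torusBand L k - b < -τ := by linarith [hk.2]
        have hξ0 : torusBand L k - b < 0 := by linarith
        refine le_trans ?_ (le_occupation_of_neg hξ0 (dWaveGap k) hD)
        have hg := dWaveGap_sq_le k
        have hnum : D ^ 2 * dWaveGap k ^ 2 + D ^ 4 ≤ 4 * D ^ 2 + D ^ 4 := by nlinarith [sq_nonneg D]
        have hτ2 : τ ^ 2 ≤ (torusBand L k - b) ^ 2 := by nlinarith
        have : (D ^ 2 * dWaveGap k ^ 2 + D ^ 4) / (2 * (torusBand L k - b) ^ 2) ≤ (4 * D ^ 2 + D ^ 4) / (2 * τ ^ 2) :=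
          calc (D ^ 2 * dWaveGap k ^ 2 + D ^ 4) / (2 * (torusBand L k - b) ^ 2)
              ≤ (4 * D ^ 2 + D ^ 4) / (2 * (torusBand L k - b) ^ 2) := by gcongr
            _ ≤ (4 * D ^ 2 + D ^ 4) / (2 * τ ^ 2) := by gcongr
        linarith
    _ ≤ _ := Finset.sum_le_sum_of_subset_of_nonneg (Finset.filter_subset _ _) fun k _ _ =>
        (occupation_mem (torusBand L k - b) (dWaveGap k) hD).1

/-- **Tuning the chemical potential (piece 3b(v) of `stub_edgeOrder`).** For `0 < D ≤ 1/100` and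
`K ≥ 0` there is `L₀` such that for all `L ≥ L₀` every target `t ∈ [0.6L² − 2KL − 2, 0.9L²]` is the
mean number of the regularised BCS trial state at some `|μ| ≤ 19/5`:
`Σ_k (1 − (ε_L(k) − μ)/√((ε_L(k) − μ)² + D²ĝ_d(k)² + D⁴)) = t`. [folklore] -/
theorem exists_mu_of_target {D : ℝ} (hD : 0 < D) (hD1 : D ≤ 1 / 100) {K : ℝ} (hK : 0 ≤ K) :
    ∃ L₀ : ℕ, ∀ (L : ℕ) [NeZero L], L₀ ≤ L → ∀ t : ℝ, 3 / 5 * (L : ℝ) ^ 2 - 2 * K * L - 2 ≤ t → t ≤ 9 / 10 * (L : ℝ) ^ 2 →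
      ∃ μ : ℝ, |μ| ≤ 19 / 5 ∧ ∑ k : TorusSite 2 L,
        (1 - (torusBand L k - μ) / Real.sqrt ((torusBand L k - μ) ^ 2 + D ^ 2 * dWaveGap k ^ 2 + D ^ 4)) = t := by
  refine ⟨⌈8 * K⌉₊ + 16, fun L _ hL t ht1 ht2 => ?_⟩
  have hLK : 8 * K + 16 ≤ (L : ℝ) := by
    have h1 : (⌈8 * K⌉₊ : ℝ) + 16 ≤ L := by exact_mod_cast hL
    have h2 : 8 * K ≤ (⌈8 * K⌉₊ : ℝ) := Nat.le_ceil _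
    linarith
  have hL16 : (16 : ℝ) ≤ L := by linarith
  set a : ℝ := -15 / 4 - 4 * D with ha
  set b : ℝ := 15 / 4 + 5 * D with hb
  set f : ℝ → ℝ := fun μ => ∑ k : TorusSite 2 L,
    (1 - (torusBand L k - μ) / Real.sqrt ((torusBand L k - μ) ^ 2 + D ^ 2 * dWaveGap k ^ 2 + D ^ 4)) with hf
  have hcont : Continuous f := continuous_occSum hD
  have hτ : (0 : ℝ) < 4 * D := by positivity
  have hD2 : D ^ 2 ≤ 1 := by nlinarith
  have hfrac : (4 * D ^ 2 + D ^ 4) / (2 * (4 * D) ^ 2) ≤ 5 / 32 := by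
    rw [div_le_div_iff₀ (by positivity) (by norm_num)]
    nlinarith [sq_nonneg D]
  -- `f a ≤ t`
  have hfa : f a ≤ t := by
    have h1 := occSum_le (L := L) a hτ hD
    have hlev := torusLevelCount_bottom_le (L := L) (s := 1 / 2) (by norm_num)
    have e : a + 4 * D = -4 + (1 / 2 : ℝ) ^ 2 := by rw [ha]; norm_num
    rw [e] at h1
    have h2 : (L : ℝ) ^ 2 * ((4 * D ^ 2 + D ^ 4) / (2 * (4 * D) ^ 2)) ≤ (L : ℝ) ^ 2 * (5 / 32) :=
      mul_le_mul_of_nonneg_left hfrac (by positivity)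
    have h3 : f a ≤ 2 * ((1 / 2 * L / 2 + 2) ^ 2) + (L : ℝ) ^ 2 * (5 / 32) := by
      calc f a ≤ 2 * (torusLevelCount L (-4 + (1 / 2 : ℝ) ^ 2) : ℝ) + (L : ℝ) ^ 2 * ((4 * D ^ 2 + D ^ 4) / (2 * (4 * D) ^ 2)) := h1
        _ ≤ _ := by gcongr
    nlinarith
  -- `t ≤ f b`
  have hfb : t ≤ f b := by
    have hE : (15 / 4 : ℝ) + 4 * D < b := by rw [hb]; linarith
    have h1 := le_occSum (L := L) b hτ hE hD
    have hlev := sq_sub_torusLevelCount_top_le (L := L) (s := 1 / 2) (by norm_num)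
    have e : (4 : ℝ) - (1 / 2) ^ 2 = 15 / 4 := by norm_num
    rw [e] at hlev
    have hcnt : (L : ℝ) ^ 2 - (1 / 2 * L / 2 + 2) ^ 2 ≤ torusLevelCount L (15 / 4) := by linarith
    have hfac : (59 / 32 : ℝ) ≤ 2 - (4 * D ^ 2 + D ^ 4) / (2 * (4 * D) ^ 2) := by linarith
    have hcnt0 : (0 : ℝ) ≤ torusLevelCount L (15 / 4) := Nat.cast_nonneg _
    have h2 : 59 / 32 * ((L : ℝ) ^ 2 - (1 / 2 * L / 2 + 2) ^ 2) ≤ f b :=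
      calc 59 / 32 * ((L : ℝ) ^ 2 - (1 / 2 * L / 2 + 2) ^ 2) ≤ 59 / 32 * (torusLevelCount L (15 / 4) : ℝ) := by
            gcongr
        _ ≤ (2 - (4 * D ^ 2 + D ^ 4) / (2 * (4 * D) ^ 2)) * (torusLevelCount L (15 / 4) : ℝ) :=
            mul_le_mul_of_nonneg_right hfac hcnt0
        _ ≤ f b := h1
    nlinarith
  -- intermediate value theorem on `[a, b]`
  have hab : a ≤ b := by rw [ha, hb]; linarith
  obtain ⟨μ, hμ, hfμ⟩ := intermediate_value_Icc hab hcont.continuousOn ⟨hfa, hfb⟩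
  refine ⟨μ, ?_, hfμ⟩
  rw [abs_le]
  obtain ⟨hμ1, hμ2⟩ := hμ
  constructor <;> linarith

/-- **Tuning the chemical potential (piece 3b(v) of `stub_edgeOrder`)**, closed form. [folklore] -/
theorem bcsTrial_tuning :
    ∀ (D : ℝ), 0 < D → D ≤ 1 / 100 → ∀ (K : ℝ), 0 ≤ K → ∃ L₀ : ℕ, ∀ (L : ℕ) [NeZero L], L₀ ≤ L → ∀ t : ℝ, 3 / 5 * (L : ℝ) ^ 2 - 2 * K * L - 2 ≤ t → t ≤ 9 / 10 * (L : ℝ) ^ 2 → ∃ μ : ℝ, |μ| ≤ 19 / 5 ∧ ∑ k : TorusSite 2 L, (1 - (torusBand L k - μ) / Real.sqrt ((torusBand L k - μ) ^ 2 + D ^ 2 * dWaveGap k ^ 2 + D ^ 4)) = t :=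
  fun _ hD hD1 _ hK => exists_mu_of_target hD hD1 hK

end Summit.HubbardSuperconductivity.TwTipContinuation.IsogapTransport
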